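import Summits.ResolutionOfSingularities.ResolutionOfSingularities.Theorems.MarkedTransferCampaignW46MohWindowShadeTerminationStatement
import Summits.ResolutionOfSingularities.ResolutionOfSingularities.Theorems.MarkedTransferCampaignW46MohWindowShadeFormalBranch
import HarnessLib

/-!
# [OURS · L1 W4.6] Rung (iii) "Moh window", SURFACES — the FINAL-FORM termination predicate CLOSED BY NAME (proofs only)

Cell `res-hironaka`, rung L, slot W4.6, seat `res-L1-s46-pv-6` (gen 3).  `--kind proof --supports
stmt-ResolutionOfSingularities-16155 --as helper`.  Closes `CampaignW46MohWindowShadeSurfaceMeetsFormalCurve p K σ`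
(`…TerminationStatement.lean` v2) for every prime `p`, every field `K` of characteristic `p` and every finite index type,
by the seat's `MohWindowShadeFormalBranch.exists_formal_pfold_curve_of_walk`: along every infinite in-window walk of
equimultiple point blow-ups of `x^p + F(y_j, y_i)` in the Hauser–Wagner frame some residual polynomial is divisible in
`K[[y_j, y_i]]` by the `p`-th power of a smooth formal curve germ.  OURS; NOT a statement of the manuscript
[claim: Hironaka2017, status: under-review], nothing of which is used.  AI review is weaker than expert review.
-/

noncomputable section

set_option linter.dupNamespace false -- mandated namespace of this single-conjunct summit

open MvPolynomial Finset

namespace Summit.ResolutionOfSingularities.ResolutionOfSingularities.Theorems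

open Literature.AlgebraicGeometry.Resolution
open Literature.AlgebraicGeometry.Resolution.PointBlowup
open Literature.AlgebraicGeometry.Resolution.Hauser2010

/-- **[OURS · L1 W4.6] Rung (iii), surfaces, termination — FINAL FORM, CLOSED BY NAME.**  For every prime `p`, every
field `K` of characteristic `p` and every finite index type, `CampaignW46MohWindowShadeSurfaceMeetsFormalCurve p K σ`
holds.  NOT a statement of the manuscript. [folklore] -/
theorem campaignW46MohWindowShadeSurfaceMeetsFormalCurve_holds (p : ℕ) [Fact p.Prime] (K : Type*) [Field K]
    [DecidableEq K] [CharP K p] (σ : Type*) [Fintype σ] [DecidableEq σ] :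
    CampaignW46MohWindowShadeSurfaceMeetsFormalCurve p K σ := by
  intro j i hij htwo s c b hb hHW hstep hclean hr heq hwin
  exact CampaignW46.MohWindowShadeFormalBranch.exists_formal_pfold_curve_of_walk p hij htwo s c b hb hHW hstep hclean
    hr heq hwin

end Summit.ResolutionOfSingularities.ResolutionOfSingularities.Theorems
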